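import Mathlib
import Summits.QuantumFields.YangMills.Theorems.BalabanUVNodesN15BackgroundStep
import Summits.QuantumFields.YangMills.Theorems.BalabanUVNodesN15RiemannWire
import Summits.QuantumFields.YangMills.Theorems.BalabanUVNodesN15DerivDefectLattices
import Summits.QuantumFields.YangMills.Theorems.BalabanUVNodesN15DerivDefectMajorant
import HarnessLib

/-!
# Route «BalabanUVNodes» (cluster K4 «SpineRates»), Track-A DAG node N15 = spine estimate NE2, BACKGROUND LAYER — THE BACKGROUND STEP
# INHABITED NON-TRIVIALLY (S6-MODEL): on the windows of g0's file 10, the background-dependent model propagators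
# `X = (1 − G₁M_c)⁻¹G₁` (coarse) and `X′ = (1 − G₁′M_{c′})⁻¹G₁′` (fine), `G₁, G₁′` the discretised kernels of ONE Lipschitz profile at the two
# spacings and `M_c, M_{c′}` a GENUINE zeroth-order perturbation, have an η-defect majorant — every binder of
# `…N15.BackgroundStep.idef_background_propagator_majorant_flat` DISCHARGED except the coefficient-fit letter `o` (which parts 12a–12d supply)

Cell `pub-ymgap`, seat `pub-ymgap-dag-n15-b` (generation g2; FIRST-MISSING-ESTIMATE, HUMAN RULING D-0062; chair R424 venue; ROSTER-D0062 l.26).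
`bears_on: R4∕N15`.  Filed `--supports stmt-QuantumFields-19351`.  Residue (ii) of g0's memo §4 («an S6-MODEL with a genuine first-order V on the windows of
file 10 … honest model») in its zeroth-order form, and the answer to the referee's standing remark on the -b chain, ref-B READ #96 (INBOX l.10109): *«D2
satisfiable (V ≡ 0 ∕ A ≡ 0)»* — here D2 is met with `V = M_c ≠ 0` and a non-degenerate pairing (`M ≥ 2` allowed), every constant explicit.

THE PRINT (MECHANISM and SHAPES only; nothing of [B9] asserted).  [Balaban1985BackgroundPropagators] (3.62)–(3.65) pp. 402–403 (verbatim in the tree header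
`B9Thm34Ext`): *«the operator V′(A)G′(U) satisfies the bound … (3.63) … I − V′(A)G′(U) is an invertible operator, the inverse is given by a convergent Neumann
series … G′(U′U) = G′(U) + G′(U)V′(A)G′(U′U) (3.65)»*.  Here: the INVERSE is constructed (finite lattice: `1 − G₁M_c` is injective by the row-sum contraction
`|Ω|·η^d·B·r < 1` — the model's (3.63) —, hence a unit, `Matrix.mulVec_injective_iff_isUnit`), the fixed-point equations (3.64)∕(3.65) hold BY CONSTRUCTION
(`neumannSol_fix`), and g0's background step is APPLIED with: binder (a) = file 10's `hasMaj_idef_riemannKernel` (the `U ≡ 1` defect `Lip·η^{d+1}`), (b) = the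
contraction `q = |Ω|η^dBr < 1`, (c) = the Neumann majorant of `X` (`B9SectDWeightedNeumann.neumann_majorant_wrow`) times `r`, (d) = the sandwiched coefficient
defect `G₁′ ∘ M_{c′ − c∘π} ∘ pull π ∘ X` from the FIT LETTER `|c′(x′) − c(πx′)| ≤ o(πx′)` (`T4EtaRateCoeffDefect.hasMaj_idef_mulOp`), (f) = automatic
(`exists_const_hasMaj_ofBlocks`).  The fit letter `o` is the ONE input left symbolic: parts 12a–12d of this seat discharge it for every coefficient species
(e.g. `c′ = phi1(η′, A′)`, `c = phi1(η, blockMean A′)`: `fit_phi1_blockMean` + 12a `hfit_of_pointwise`, `o = e·d(M−1)θ₁ + 2r²η` — ONE rate factor).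

CONTENTS ([folklore]: finite-dimensional linear algebra + g0∕n15-a∕this seat's lemmas BY NAME).
* §1 MATRIX NEUMANN: `mulVec_sub_injective_of_rowSum` (row sums of `|T|` `≤ q < 1` ⟹ `1 − T` injective: sup-norm contraction), `isUnit_one_sub_of_rowSum`,
  `neumannSol T K = (1 − T)⁻¹K`, `neumannSol_fix` (`X = K + T·X`), `mulVecLin_neumannSol_fix` (the fixed-point equation as linear maps with the step
  `K.mulVecLin ∘ M_c`, `mulOp_eq_mulVecLin_diagonal`).
* §2 THE MODEL on the windows of file 10 (`siteGeo`, `fineWindow`, `blockProjW`, `fineKernel`, `coarseKernel` BY NAME): row sums of the two kernels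
  (`rowSum_coarseKernel_le`, `rowSum_fineKernel_le`: both `≤ |Ω|·η^d·B`, `η = Mη′`), block majorants of the kernels (`hasMaj_coarseKernel`, `hasMaj_fineKernel`:
  `η^dB`), of the steps `G₁M_c`, `G₁′M_{c′}` (`η^dBr`, weighted row norm `q`), `triangle254_siteGeo`, `wrow_const_siteGeo`.
* §3 **`idef_modelPropagator_majorant`** — THE BACKGROUND STEP INHABITED: with `q = |Ω|η^dBr < 1`,
  `𝔇(X′, X) ≤ (m_G + m_G·A_V + c_V)·(1 − q)⁻¹` blockwise, `m_G = |Ω|·Lip·η^{d+1}`, `A_V = r·η^dB(1 − q)⁻¹`, `c_V = η^dB·η^dB(1 − q)⁻¹·Σ_y o(y)` — the U ≡ 1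
  rate `Lip·η^{d+1}` and the fit letter `o` are the only small quantities, as the record says (one rate factor each).

HONEST FRAMING ∕ LIMITS.  MODEL: zero-range geometry (plain operator bounds, NO decay), scalar fields, ZEROTH-order perturbation `M_c` only (the first-order
`M_a∇` term is g0 file 4's + 12e's business and needs the (3.42)₂∕₃-shaped entries of the model kernels — not here), one Lipschitz profile `k` for both runs,
crude constants; nothing about Bałaban's `G′(U)`.  NE2⁺ NOT PRINTED, NOT proved; count-neutral (typed 28∕28; nothing discharged); finite windows — NOT infinite
volume, NOT OS on ℝ⁴, NOT a mass gap, NOT Clay.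
-/

noncomputable section

namespace Summit.QuantumFields.YangMills.BalabanUVNodes.N15.BackgroundModel

open Literature.MathematicalPhysics.QuantumFieldTheory.Balaban1983to89
open Literature.MathematicalPhysics.QuantumFieldTheory.Balaban1983to89.B11SectG (BlockNorm HasMaj hasMaj_comp)
open Literature.MathematicalPhysics.QuantumFieldTheory.Balaban1983to89.T4EtaRateDefect (idef)
open Literature.MathematicalPhysics.QuantumFieldTheory.Balaban1983to89.T4EtaRateCoeffDefect (pull pull_apply diagK diagK_nonneg fibre mem_fibre
  hasMaj_mulOp hasMaj_idef_mulOp)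
open Literature.MathematicalPhysics.QuantumFieldTheory.Balaban1983to89.B9SectDWeightedNeumann (WRow neumann_majorant_wrow)
open Literature.MathematicalPhysics.QuantumFieldTheory.Balaban1983to89.B6RandomWalk (Triangle254)
open Literature.MathematicalPhysics.QuantumFieldTheory.Balaban1983to89.B6Prop26Gluing (mulOp mulOp_apply)
open Literature.MathematicalPhysics.QuantumLattice (blockMap blockSites card_blockSites)
open Literature.Probability.LatticeModels (Site)
open Summit.QuantumFields.YangMills.BalabanUVNodes.N15.DerivDefect (sum_diagK_mul sum_mul_diagK exists_const_hasMaj_ofBlocks)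
open Summit.QuantumFields.YangMills.BalabanUVNodes.N15.DefectKernel (hasMaj_ofBlocks_of_entry_le)
open Summit.QuantumFields.YangMills.BalabanUVNodes.N15.RiemannWire (fineWindow blockProjW blockProjW_val siteGeo fineKernel coarseKernel
  mulVecLin_single map_fibre_blockProjW sum_fibre_blockProjW hasMaj_idef_riemannKernel entry_coarseKernel_le)
open Summit.QuantumFields.YangMills.BalabanUVNodes.N15.BackgroundStep (idef_background_propagator_majorant_flat)

/-! ## §1 Matrix Neumann: a row-sum contraction makes `1 − T` a unit; the fixed-point equation by construction -/

section Neumann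

variable {n : Type} [Fintype n] [DecidableEq n]

omit [DecidableEq n] in
/-- SUP-NORM CONTRACTION: if every row of `|T|` sums to `≤ q < 1`, then `v = T·v ⟹ v = 0`. [folklore] -/
theorem eq_zero_of_mulVec_eq_self {T : Matrix n n ℝ} {q : ℝ} (hq : q < 1) (hrow : ∀ i, ∑ j, |T i j| ≤ q) {v : n → ℝ}
    (hv : T.mulVec v = v) : v = 0 := by
  rcases isEmpty_or_nonempty n with hn | hn
  · funext i; exact (IsEmpty.false i).elim
  obtain ⟨i₀, -, hi₀⟩ := Finset.exists_max_image Finset.univ (fun i => |v i|) Finset.univ_nonempty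
  have hmax : ∀ j, |v j| ≤ |v i₀| := fun j => hi₀ j (Finset.mem_univ j)
  have hkey : |v i₀| ≤ q * |v i₀| := by
    have h := congr_fun hv i₀
    simp only [Matrix.mulVec, dotProduct] at h
    calc |v i₀| = |∑ j, T i₀ j * v j| := by rw [h]
      _ ≤ ∑ j, |T i₀ j * v j| := Finset.abs_sum_le_sum_abs _ _
      _ = ∑ j, |T i₀ j| * |v j| := Finset.sum_congr rfl fun j _ => abs_mul _ _
      _ ≤ ∑ j, |T i₀ j| * |v i₀| := Finset.sum_le_sum fun j _ => mul_le_mul_of_nonneg_left (hmax j) (abs_nonneg _)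
      _ = (∑ j, |T i₀ j|) * |v i₀| := by rw [Finset.sum_mul]
      _ ≤ q * |v i₀| := mul_le_mul_of_nonneg_right (hrow i₀) (abs_nonneg _)
  have h0 : |v i₀| = 0 := by nlinarith [abs_nonneg (v i₀)]
  funext j
  have := hmax j
  rw [h0] at this
  exact abs_eq_zero.1 (le_antisymm this (abs_nonneg _))

/-- `1 − T` is injective on vectors under the row-sum contraction. [folklore] -/
theorem mulVec_sub_injective_of_rowSum {T : Matrix n n ℝ} {q : ℝ} (hq : q < 1) (hrow : ∀ i, ∑ j, |T i j| ≤ q) :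
    Function.Injective (1 - T).mulVec := by
  intro v w hvw
  have h : T.mulVec (v - w) = v - w := by
    have h1 : (1 - T).mulVec (v - w) = 0 := by rw [Matrix.mulVec_sub, hvw, sub_self]
    rw [Matrix.sub_mulVec, Matrix.one_mulVec, sub_eq_zero] at h1
    exact h1.symm
  exact sub_eq_zero.1 (eq_zero_of_mulVec_eq_self hq hrow h)

/-- Hence `1 − T` is a unit (finite dimension: `Matrix.mulVec_injective_iff_isUnit`) — the model's (3.63) ⟹ (3.64). [folklore] -/
theorem isUnit_one_sub_of_rowSum {T : Matrix n n ℝ} {q : ℝ} (hq : q < 1) (hrow : ∀ i, ∑ j, |T i j| ≤ q) : IsUnit (1 - T) :=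
  Matrix.mulVec_injective_iff_isUnit.1 (mulVec_sub_injective_of_rowSum hq hrow)

/-- THE NEUMANN SOLUTION `X = (1 − T)⁻¹·K` of `X = K + T·X`. [folklore] -/
def neumannSol (T K : Matrix n n ℝ) : Matrix n n ℝ := (1 - T)⁻¹ * K

/-- `(1 − T)·X = K`. [folklore] -/
theorem one_sub_mul_neumannSol {T : Matrix n n ℝ} {q : ℝ} (hq : q < 1) (hrow : ∀ i, ∑ j, |T i j| ≤ q) (K : Matrix n n ℝ) :
    (1 - T) * neumannSol T K = K := by
  unfold neumannSol
  rw [← Matrix.mul_assoc, Matrix.mul_nonsing_inv _ ((Matrix.isUnit_iff_isUnit_det _).1 (isUnit_one_sub_of_rowSum hq hrow)),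
    Matrix.one_mul]

/-- THE FIXED-POINT EQUATION (3.65) BY CONSTRUCTION: `X = K + T·X`. [folklore] -/
theorem neumannSol_fix {T : Matrix n n ℝ} {q : ℝ} (hq : q < 1) (hrow : ∀ i, ∑ j, |T i j| ≤ q) (K : Matrix n n ℝ) :
    neumannSol T K = K + T * neumannSol T K := by
  have h := one_sub_mul_neumannSol hq hrow K
  rw [Matrix.sub_mul, Matrix.one_mul, sub_eq_iff_eq_add] at h
  exact h

/-- The multiplication operator is the diagonal matrix. [folklore] -/
theorem mulOp_eq_mulVecLin_diagonal (c : n → ℝ) : mulOp c = (Matrix.diagonal c).mulVecLin := by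
  refine LinearMap.ext fun v => funext fun x => ?_
  rw [mulOp_apply, Matrix.mulVecLin_apply, Matrix.mulVec_diagonal]

/-- THE FIXED-POINT EQUATION AS LINEAR MAPS with the step `G₁ ∘ M_c` (`T = K·diag c`): the `hfix` binder of the background step. [folklore] -/
theorem mulVecLin_neumannSol_fix {K : Matrix n n ℝ} {c : n → ℝ} {q : ℝ} (hq : q < 1)
    (hrow : ∀ i, ∑ j, |(K * Matrix.diagonal c) i j| ≤ q) :
    (neumannSol (K * Matrix.diagonal c) K).mulVecLin =
      K.mulVecLin + (K.mulVecLin ∘ₗ mulOp c) ∘ₗ (neumannSol (K * Matrix.diagonal c) K).mulVecLin := by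
  conv_lhs => rw [neumannSol_fix hq hrow K]
  rw [Matrix.mulVecLin_add, Matrix.mulVecLin_mul, Matrix.mulVecLin_mul, mulOp_eq_mulVecLin_diagonal]

/-- Row sums of `|K·diag c|` from row sums of `|K|` and `|c| ≤ r`. [folklore] -/
theorem rowSum_mul_diagonal_le {K : Matrix n n ℝ} {c : n → ℝ} {r β : ℝ} (hr : ∀ j, |c j| ≤ r) (hK : ∀ i, ∑ j, |K i j| ≤ β)
    (i : n) : ∑ j, |(K * Matrix.diagonal c) i j| ≤ β * r := by
  have hr0 : 0 ≤ r := (abs_nonneg _).trans (hr i)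
  calc ∑ j, |(K * Matrix.diagonal c) i j| = ∑ j, |K i j| * |c j| := by
        refine Finset.sum_congr rfl fun j _ => ?_
        rw [Matrix.mul_diagonal, abs_mul]
    _ ≤ ∑ j, |K i j| * r := Finset.sum_le_sum fun j _ => mul_le_mul_of_nonneg_left (hr j) (abs_nonneg _)
    _ = (∑ j, |K i j|) * r := by rw [Finset.sum_mul]
    _ ≤ β * r := mul_le_mul_of_nonneg_right (hK i) hr0

end Neumann

/-! ## §2 The model on the windows of file 10: row sums and block majorants of the kernels and of the steps -/

section Model

variable {d : ℕ} (M : ℕ) [NeZero M] (Ω : Finset (Site d))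

/-- The zero-range geometry satisfies (2.54) trivially. [folklore] -/
theorem triangle254_siteGeo (X : Type) [Fintype X] : Triangle254 (siteGeo X) := fun _ _ _ => by
  show (0 : ℝ) ≤ 0 + 0
  norm_num

/-- Weighted row norm of a CONSTANT kernel on the zero-range geometry: `|X|·N`. [folklore] -/
theorem wrow_const_siteGeo (X : Type) [Fintype X] (N ρ : ℝ) :
    WRow (siteGeo X) ρ (fun _ _ => N) (Fintype.card X * N) := fun y => by
  show ∑ y' : X, N * Real.exp (ρ * 0) ≤ Fintype.card X * N
  simp

/-- ROW SUMS OF THE COARSE KERNEL: `Σ_u |η^d k(η(y − u))| ≤ |Ω|·η^d·B`. [folklore] -/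
theorem rowSum_coarseKernel_le (k : (Fin d → ℝ) → ℝ) {B η : ℝ} (hη : 0 ≤ η) (hB : ∀ a, |k a| ≤ B) (y : {y // y ∈ Ω}) :
    ∑ u, |coarseKernel Ω k η y u| ≤ Ω.card * (η ^ d * B) := by
  calc ∑ u, |coarseKernel Ω k η y u| ≤ ∑ _u : {y // y ∈ Ω}, η ^ d * B :=
        Finset.sum_le_sum fun u _ => entry_coarseKernel_le Ω k hη hB y u
    _ = Ω.card * (η ^ d * B) := by rw [Finset.sum_const, Finset.card_univ, Fintype.card_coe, nsmul_eq_mul]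

omit [NeZero M] in
/-- Entries of the fine kernel: `|η′^d k(·)| ≤ η′^d·B`. [folklore] -/
theorem entry_fineKernel_le (k : (Fin d → ℝ) → ℝ) {B η' : ℝ} (hη' : 0 ≤ η') (hB : ∀ a, |k a| ≤ B)
    (x' u' : {x // x ∈ fineWindow M Ω}) : |fineKernel M Ω k η' x' u'| ≤ η' ^ d * B := by
  unfold fineKernel
  rw [abs_mul, abs_of_nonneg (pow_nonneg hη' d)]
  exact mul_le_mul_of_nonneg_left (hB _) (pow_nonneg hη' d)

/-- The fibre of the window projection has `M^d` points (the whole block). [folklore] -/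
theorem card_fibre_blockProjW (u : {y // y ∈ Ω}) : (fibre (blockProjW M Ω) u).card = M ^ d := by
  rw [← Finset.card_map (Function.Embedding.subtype _), map_fibre_blockProjW, card_blockSites]

omit [NeZero M] in
/-- `(Mη′)^d = M^d·η′^d` bookkeeping: `M^d·(η′^d·B) = η^d·B` for `η = Mη′`. [folklore] -/
theorem pow_mul_eq {η η' : ℝ} (hη : η = (M : ℝ) * η') (B : ℝ) : (M : ℝ) ^ d * (η' ^ d * B) = η ^ d * B := by
  rw [hη, mul_pow]; ring

/-- ROW SUMS OF THE FINE KERNEL: `Σ_{u′} |η′^d k(η′(x′ − u′))| ≤ |Ω|·η^d·B` (`η = Mη′`: `M^d` points per block). [folklore] -/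
theorem rowSum_fineKernel_le (k : (Fin d → ℝ) → ℝ) {B η η' : ℝ} (hη' : 0 ≤ η') (hη : η = (M : ℝ) * η') (hB : ∀ a, |k a| ≤ B)
    (x' : {x // x ∈ fineWindow M Ω}) : ∑ u', |fineKernel M Ω k η' x' u'| ≤ Ω.card * (η ^ d * B) := by
  classical
  rw [← Finset.sum_fiberwise Finset.univ (blockProjW M Ω) fun u' => |fineKernel M Ω k η' x' u'|]
  have hfib : ∀ u : {y // y ∈ Ω}, (Finset.univ.filter fun u' => blockProjW M Ω u' = u) = fibre (blockProjW M Ω) u := fun u => rfl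
  calc ∑ u, ∑ u' ∈ Finset.univ.filter (fun u' => blockProjW M Ω u' = u), |fineKernel M Ω k η' x' u'|
      ≤ ∑ _u : {y // y ∈ Ω}, (M : ℝ) ^ d * (η' ^ d * B) := Finset.sum_le_sum fun u _ => by
        rw [hfib]
        calc ∑ u' ∈ fibre (blockProjW M Ω) u, |fineKernel M Ω k η' x' u'|
            ≤ ∑ _u' ∈ fibre (blockProjW M Ω) u, η' ^ d * B := Finset.sum_le_sum fun u' _ => entry_fineKernel_le M Ω k hη' hB x' u'
          _ = (M : ℝ) ^ d * (η' ^ d * B) := by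
              rw [Finset.sum_const, card_fibre_blockProjW, nsmul_eq_mul]; push_cast; ring
    _ = Ω.card * (η ^ d * B) := by
        rw [Finset.sum_const, Finset.card_univ, Fintype.card_coe, nsmul_eq_mul, pow_mul_eq M hη]

/-- BLOCK MAJORANT OF THE COARSE KERNEL (single-site cubes): `η^d·B`. [folklore] -/
theorem hasMaj_coarseKernel (k : (Fin d → ℝ) → ℝ) {B η : ℝ} (hη : 0 ≤ η) (hB : ∀ a, |k a| ≤ B) :
    HasMaj (BlockNorm.ofBlocks (siteGeo {y // y ∈ Ω}) (fun y => y)) (BlockNorm.ofBlocks (siteGeo {y // y ∈ Ω}) (fun y => y))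
      (Matrix.mulVecLin (coarseKernel Ω k η)) (fun _ _ => ((1 : ℕ) : ℝ) * (η ^ d * B)) := by
  classical
  have hB0 : 0 ≤ B := (abs_nonneg _).trans (hB 0)
  refine hasMaj_ofBlocks_of_entry_le (g := siteGeo {y // y ∈ Ω}) (fun y => y) (fun y => y) (κ := fun _ _ => η ^ d * B) (n₀ := 1)
    (fun _ _ => mul_nonneg (pow_nonneg hη d) hB0) (fun y' => ?_) fun x u => ?_
  · have : fibre (fun y : {y // y ∈ Ω} => y) y' = {y'} := by
      ext z; rw [mem_fibre, Finset.mem_singleton]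
    rw [this, Finset.card_singleton]
  · rw [mulVecLin_single]
    exact entry_coarseKernel_le Ω k hη hB x u

/-- BLOCK MAJORANT OF THE FINE KERNEL (block cubes of `M^d` points): `M^d·η′^d·B = η^d·B`. [folklore] -/
theorem hasMaj_fineKernel (k : (Fin d → ℝ) → ℝ) {B η η' : ℝ} (hη' : 0 ≤ η') (hη : η = (M : ℝ) * η') (hB : ∀ a, |k a| ≤ B) :
    HasMaj (BlockNorm.ofBlocks (siteGeo {y // y ∈ Ω}) (blockProjW M Ω)) (BlockNorm.ofBlocks (siteGeo {y // y ∈ Ω}) (blockProjW M Ω))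
      (Matrix.mulVecLin (fineKernel M Ω k η')) (fun _ _ => η ^ d * B) := by
  classical
  have hB0 : 0 ≤ B := (abs_nonneg _).trans (hB 0)
  have key := hasMaj_ofBlocks_of_entry_le (g := siteGeo {y // y ∈ Ω}) (blockProjW M Ω) (blockProjW M Ω) (κ := fun _ _ => η' ^ d * B)
    (n₀ := M ^ d) (T := Matrix.mulVecLin (fineKernel M Ω k η')) (fun _ _ => mul_nonneg (pow_nonneg hη' d) hB0)
    (fun y' => (card_fibre_blockProjW M Ω y').le) fun x' u' => by
      rw [mulVecLin_single]; exact entry_fineKernel_le M Ω k hη' hB x' u'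
  refine key.mono fun _ _ => le_of_eq ?_
  push_cast
  exact pow_mul_eq M hη B

/-- Constant left factor against a diagonal kernel: `Σ_x β·(1_{x=b}·o(b)) = β·o(b)`. [folklore] -/
theorem sum_const_mul_diagK {g : B6.Geometry} (β : ℝ) (o : g.Site → ℝ) (b : g.Site) : ∑ x, β * diagK o x b = β * o b :=
  sum_mul_diagK o (fun _ => β) b

/-- Diagonal kernel against a constant right factor: `Σ_x (1_{a=x}·o(x))·β = o(a)·β`. [folklore] -/
theorem sum_diagK_mul_const {g : B6.Geometry} (o : g.Site → ℝ) (β : ℝ) (a : g.Site) : ∑ x, diagK o a x * β = o a * β :=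
  sum_diagK_mul o (fun _ => β) a

/-- The cutting constant of every sharp block norm is `1`. [folklore] -/
theorem kappa_ofBlocks {g : B6.Geometry} {X : Type} [Fintype X] (blk : X → g.Site) : (BlockNorm.ofBlocks g blk).κ = 1 := rfl

/-- BLOCK MAJORANT OF A STEP `G ∘ M_c` from a constant majorant `β` of `G` and `|c| ≤ r`: the constant `β·r`. [folklore] -/
theorem hasMaj_step {X Y : Type} [Fintype X] [Fintype Y] [DecidableEq X] (blk : X → {y // y ∈ Ω})
    {G : (X → ℝ) →ₗ[ℝ] (Y → ℝ)} {bY : BlockNorm (siteGeo {y // y ∈ Ω}) (Y → ℝ)} {β r : ℝ} (hβ : 0 ≤ β) (hr : 0 ≤ r)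
    (hG : HasMaj (BlockNorm.ofBlocks (siteGeo {y // y ∈ Ω}) blk) bY G (fun _ _ => β)) {c : X → ℝ} (hc : ∀ x, |c x| ≤ r) :
    HasMaj (BlockNorm.ofBlocks (siteGeo {y // y ∈ Ω}) blk) bY (G ∘ₗ mulOp c) (fun _ _ => β * r) := by
  have hM := hasMaj_mulOp (g := siteGeo {y // y ∈ Ω}) blk (m := fun _ => r) (fun _ => hr) fun x => hc x
  have key := hasMaj_comp hG hM (fun _ _ => hβ)
  refine key.mono fun a b => le_of_eq ?_
  exact (Finset.sum_congr rfl fun y'' _ => by rw [kappa_ofBlocks, one_mul]).trans (sum_const_mul_diagK β (fun _ => r) b)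

end Model

/-! ## §3 The background step inhabited: the η-defect of the model background-dependent propagators -/

section Main

variable {d : ℕ} (M : ℕ) [NeZero M] (Ω : Finset (Site d))

/-- **THE BACKGROUND STEP INHABITED (S6-MODEL, zeroth-order perturbation).**  Data: a profile `k` with `|k| ≤ B` and Lipschitz constant `Lip` (sup
norm); spacings `η′ ≥ 0`, `η = Mη′`; coefficients `c′` (fine window), `c` (coarse window) of size `≤ r` with the FIT LETTER `|c′(x′) − c(⌊x′∕M⌋)| ≤ o(⌊x′∕M⌋)`,
`o ≥ 0`; the contraction `q = |Ω|·η^d·B·r < 1` (the model's (3.63)).  Objects: `G₁ = coarseKernel`, `G₁′ = fineKernel` (file 10), the background-dependent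
propagators `X = (1 − G₁M_c)⁻¹G₁`, `X′ = (1 − G₁′M_{c′})⁻¹G₁′` (`neumannSol`, units by §1).  CONCLUSION: the η-defect `𝔇(X′, X) = X′∘pull − pull∘X` has
the block majorant (single-site cubes → blocks, zero-range geometry)
`(m_G + m_G·A_V + c_V)·(1 − q)⁻¹`, `m_G = |Ω|·Lip·η^{d+1}`, `A_V = (η^dB)·r·(1 − q)⁻¹`, `c_V = (η^dB)·(η^dB)(1 − q)⁻¹·Σ_y o(y)` — g0's
`idef_background_propagator_majorant_flat` with EVERY binder discharged but the fit letter `o`. [folklore] -/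
theorem idef_modelPropagator_majorant (k : (Fin d → ℝ) → ℝ) {B Lip : ℝ} (hB : ∀ a, |k a| ≤ B) (hLip : 0 ≤ Lip)
    (hk : ∀ a b, |k a - k b| ≤ Lip * ‖a - b‖) {η η' : ℝ} (hη' : 0 ≤ η') (hη : η = (M : ℝ) * η')
    {c : {y // y ∈ Ω} → ℝ} {c' : {x // x ∈ fineWindow M Ω} → ℝ} {r : ℝ} (hr : 0 ≤ r) (hc : ∀ y, |c y| ≤ r) (hc' : ∀ x', |c' x'| ≤ r)
    {o : {y // y ∈ Ω} → ℝ} (ho : ∀ y, 0 ≤ o y) (hfit : ∀ x', |c' x' - c (blockProjW M Ω x')| ≤ o (blockProjW M Ω x'))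
    (hq : Ω.card * (η ^ d * B) * r < 1) :
    HasMaj (BlockNorm.ofBlocks (siteGeo {y // y ∈ Ω}) (fun y => y)) (BlockNorm.ofBlocks (siteGeo {y // y ∈ Ω}) (blockProjW M Ω))
      (idef (pull (blockProjW M Ω)) (pull (blockProjW M Ω))
        (neumannSol (fineKernel M Ω k η' * Matrix.diagonal c') (fineKernel M Ω k η')).mulVecLin
        (neumannSol (coarseKernel Ω k η * Matrix.diagonal c) (coarseKernel Ω k η)).mulVecLin)
      (fun _ _ =>
        (Ω.card * (Lip * η ^ (d + 1)) +
            1 * (Ω.card * (Lip * η ^ (d + 1))) * (r * ((η ^ d * B) * (1 - 1 * (Ω.card * (η ^ d * B * r)))⁻¹)) +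
            (η ^ d * B) * ((η ^ d * B) * (1 - 1 * (Ω.card * (η ^ d * B * r)))⁻¹) * ∑ y, o y) *
          (1 - 1 * (Ω.card * (η ^ d * B * r)))⁻¹ * Real.exp (-(0 * (0 : ℝ)))) := by
  classical
  -- abbreviations
  set g : B6.Geometry := siteGeo {y // y ∈ Ω} with hg
  set π := blockProjW M Ω with hπ
  set Kc := coarseKernel Ω k η with hKc
  set Kf := fineKernel M Ω k η' with hKf
  have hη0 : 0 ≤ η := by rw [hη]; positivity
  have hB0 : 0 ≤ B := (abs_nonneg _).trans (hB 0)
  have hA0 : 0 ≤ η ^ d * B := mul_nonneg (pow_nonneg hη0 d) hB0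
  have hΩ0 : (0 : ℝ) ≤ Ω.card := Nat.cast_nonneg _
  -- row sums of the steps: the contraction `q`
  have hrowc : ∀ i, ∑ j, |(Kc * Matrix.diagonal c) i j| ≤ Ω.card * (η ^ d * B) * r :=
    rowSum_mul_diagonal_le hc (rowSum_coarseKernel_le Ω k hη0 hB)
  have hrowf : ∀ i, ∑ j, |(Kf * Matrix.diagonal c') i j| ≤ Ω.card * (η ^ d * B) * r :=
    rowSum_mul_diagonal_le hc' (rowSum_fineKernel_le M Ω k hη' hη hB)
  -- the two fixed-point equations (3.65) by construction
  have hfix := mulVecLin_neumannSol_fix hq hrowc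
  have hfix' := mulVecLin_neumannSol_fix hq hrowf
  set Xc := (neumannSol (Kc * Matrix.diagonal c) Kc).mulVecLin with hXc
  set Xf := (neumannSol (Kf * Matrix.diagonal c') Kf).mulVecLin with hXf
  -- kernel and step majorants
  have hGc : HasMaj (BlockNorm.ofBlocks g fun y => y) (BlockNorm.ofBlocks g fun y => y) Kc.mulVecLin (fun _ _ => η ^ d * B) := by
    simpa only [Nat.cast_one, one_mul] using hasMaj_coarseKernel Ω k hη0 hB
  have hGf : HasMaj (BlockNorm.ofBlocks g π) (BlockNorm.ofBlocks g π) Kf.mulVecLin (fun _ _ => η ^ d * B) :=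
    hasMaj_fineKernel M Ω k hη' hη hB
  have hstepc : HasMaj (BlockNorm.ofBlocks g fun y => y) (BlockNorm.ofBlocks g fun y => y) (Kc.mulVecLin ∘ₗ mulOp c)
      (fun _ _ => η ^ d * B * r) := hasMaj_step Ω (fun y => y) hA0 hr hGc hc
  have hstepf : HasMaj (BlockNorm.ofBlocks g π) (BlockNorm.ofBlocks g π) (Kf.mulVecLin ∘ₗ mulOp c')
      (fun _ _ => η ^ d * B * r) := hasMaj_step Ω π hA0 hr hGf hc'
  have hwrow_step : WRow g 0 (fun _ _ => η ^ d * B * r) (Ω.card * (η ^ d * B * r)) := by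
    have h := wrow_const_siteGeo {y // y ∈ Ω} (η ^ d * B * r) 0
    rwa [Fintype.card_coe] at h
  have hq1 : (BlockNorm.ofBlocks g fun y : {y // y ∈ Ω} => y).κ * (Ω.card * (η ^ d * B * r)) < 1 := by
    show 1 * (Ω.card * (η ^ d * B * r)) < 1
    rw [one_mul, ← mul_assoc]; exact hq
  have hq2 : (BlockNorm.ofBlocks g π).κ * (Ω.card * (η ^ d * B * r)) < 1 := by
    show 1 * (Ω.card * (η ^ d * B * r)) < 1
    rw [one_mul, ← mul_assoc]; exact hq
  -- the coarse propagator's own majorant (Neumann)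
  obtain ⟨M₁, hM₁0, hapX⟩ := exists_const_hasMaj_ofBlocks (g := g) (fun y : {y // y ∈ Ω} => y) (fun y => y)
    (neumannSol (Kc * Matrix.diagonal c) Kc).mulVecLin
  have hX : HasMaj (BlockNorm.ofBlocks g fun y => y) (BlockNorm.ofBlocks g fun y => y) Xc
      (fun a b => (η ^ d * B) * (1 - (BlockNorm.ofBlocks g fun y : {y // y ∈ Ω} => y).κ * (Ω.card * (η ^ d * B * r)))⁻¹ *
        Real.exp (-(0 * g.dist a b))) :=
    neumann_majorant_wrow (triangle254_siteGeo _) (fun _ _ => le_rfl) le_rfl (fun _ _ => mul_nonneg hA0 hr) hwrow_step hA0 hM₁0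
      hstepc (by simpa using hGc) hfix hapX hq1
  have hX' : HasMaj (BlockNorm.ofBlocks g fun y => y) (BlockNorm.ofBlocks g fun y => y) Xc
      (fun _ _ => (η ^ d * B) * (1 - 1 * (Ω.card * (η ^ d * B * r)))⁻¹) :=
    hX.mono fun a b => le_of_eq (by
      have hd : g.dist a b = 0 := rfl
      rw [kappa_ofBlocks, hd]
      simp)
  have hD0 : 0 ≤ (η ^ d * B) * (1 - 1 * (Ω.card * (η ^ d * B * r)))⁻¹ := by
    refine mul_nonneg hA0 (inv_nonneg.2 ?_)
    have : 1 * (Ω.card * (η ^ d * B * r)) < 1 := by rw [one_mul, ← mul_assoc]; exact hq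
    linarith
  -- (c) the coarse `VX`
  have hVX : HasMaj (BlockNorm.ofBlocks g fun y => y) (BlockNorm.ofBlocks g fun y => y) (mulOp c ∘ₗ Xc)
      (fun y y' => r * ((η ^ d * B) * (1 - 1 * (Ω.card * (η ^ d * B * r)))⁻¹) * Real.exp (-(0 * g.dist y y'))) := by
    have hMc := hasMaj_mulOp (g := g) (fun y : {y // y ∈ Ω} => y) (m := fun _ => r) (fun _ => hr) fun x => hc x
    have key := hasMaj_comp hMc hX' (fun _ _ => diagK_nonneg (fun _ => hr) _ _)
    refine key.mono fun a b => le_of_eq ?_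
    have hd : g.dist a b = 0 := rfl
    simp only [kappa_ofBlocks, one_mul]
    rw [sum_diagK_mul_const, hd]
    simp
  -- (a) the U ≡ 1 defect (file 10)
  have hDG : HasMaj (BlockNorm.ofBlocks g fun y => y) (BlockNorm.ofBlocks g π)
      (idef (pull π) (pull π) Kf.mulVecLin Kc.mulVecLin) (fun _ _ => Lip * η ^ (d + 1)) := by
    simpa only [Nat.cast_one, one_mul] using hasMaj_idef_riemannKernel M Ω k hLip hk hη' hη
  have hwrowG : WRow g 0 (fun _ _ => Lip * η ^ (d + 1)) (Ω.card * (Lip * η ^ (d + 1))) := by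
    have h := wrow_const_siteGeo {y // y ∈ Ω} (Lip * η ^ (d + 1)) 0
    rwa [Fintype.card_coe] at h
  -- (d) the sandwiched coefficient defect from the fit letter
  have hDV : HasMaj (BlockNorm.ofBlocks g fun y => y) (BlockNorm.ofBlocks g π)
      (Kf.mulVecLin ∘ₗ idef (pull π) (pull π) (mulOp c') (mulOp c) ∘ₗ Xc)
      (fun y y' => (η ^ d * B) * ((η ^ d * B) * (1 - 1 * (Ω.card * (η ^ d * B * r)))⁻¹) * (∑ y, o y) *
        Real.exp (-(0 * g.dist y y'))) := by
    have hidef := hasMaj_idef_mulOp (g := g) (fun y : {y // y ∈ Ω} => y) π ho hfit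
    have h1 := hasMaj_comp hGf hidef (fun _ _ => hA0)
    have h1' : HasMaj (BlockNorm.ofBlocks g fun y => y) (BlockNorm.ofBlocks g π) (Kf.mulVecLin ∘ₗ idef (pull π) (pull π) (mulOp c') (mulOp c))
        (fun _ y' => (η ^ d * B) * o y') := by
      refine h1.mono fun a b => le_of_eq ?_
      simp only [kappa_ofBlocks, one_mul]
      rw [sum_const_mul_diagK]
    have h2 := hasMaj_comp h1' hX' (fun _ y' => mul_nonneg hA0 (ho y'))
    have hop : Kf.mulVecLin ∘ₗ idef (pull π) (pull π) (mulOp c') (mulOp c) ∘ₗ Xc =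
        (Kf.mulVecLin ∘ₗ idef (pull π) (pull π) (mulOp c') (mulOp c)) ∘ₗ Xc := rfl
    rw [hop]
    refine h2.mono fun a b => le_of_eq ?_
    have hd : g.dist a b = 0 := rfl
    simp only [kappa_ofBlocks, one_mul]
    rw [← Finset.sum_mul, ← Finset.mul_sum, hd]
    simp only [mul_zero, neg_zero, Real.exp_zero, mul_one]
    ring
  -- (f) a priori
  obtain ⟨M₀, hM₀0, hap⟩ := exists_const_hasMaj_ofBlocks (g := g) (fun y : {y // y ∈ Ω} => y) π (idef (pull π) (pull π) Xf Xc)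
  -- THE BACKGROUND STEP
  have key := idef_background_propagator_majorant_flat (b₁ := BlockNorm.ofBlocks g fun y => y) (b₂' := BlockNorm.ofBlocks g π)
    (τ₁ := pull π) (τ₂ := pull π) (G₁ := Kc.mulVecLin) (Xc := Xc) (V := mulOp c) (G₁' := Kf.mulVecLin) (Xf := Xf) (V' := mulOp c')
    (ρ := 0) (triangle254_siteGeo _) (fun _ _ => le_rfl) le_rfl (mul_nonneg hr hD0)
    (mul_nonneg (mul_nonneg hA0 hD0) (Finset.sum_nonneg fun y _ => ho y)) hM₀0
    (fun _ _ => mul_nonneg hA0 hr) hwrow_step (fun _ _ => mul_nonneg hLip (pow_nonneg hη0 _)) hwrowG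
    hfix hfix' hstepf hVX hDG hDV hap hq2
  refine key.mono fun a b => le_of_eq ?_
  rfl

end Main

end Summit.QuantumFields.YangMills.BalabanUVNodes.N15.BackgroundModel
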